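import Mathlib
import Summits.Ventures.HodgeRepro2.LevelPositivity
import Summits.Ventures.HodgeRepro2.T5LevelIdempotent
import Summits.Ventures.HodgeRepro2.T5LevelIdempotentDual
import Summits.Ventures.HodgeRepro2.T5AdmissibleTransfer

/-!
# Smooth vectors and the smooth dual: `(π̃)^K = (π^K)^*`

Blind cell `pub-hodge-repro2`, seat p8 (gen 8), Tier-5 kernel support.  `T5LevelIdempotentDual`
(T5-42) identifies the `K`-invariants of the ALGEBRAIC dual `V^*` with `(V^K)^*` and leaves «the
passage from the algebraic dual to the smooth dual (the `K`-invariants agree)» as prose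
(route/T5-CHECK-N3-p8.md §12.2, last row).  This file records that passage, for a topological
group `G` and a representation `ρ : Representation k G V`:

* `smoothVectors ρ : Submodule k V` — the vectors with OPEN stabiliser (`V^∞`); it is `G`-stable
  (`apply_mem_smoothVectors`: the stabiliser of `ρ g v` is the conjugate of that of `v`), contains
  `V^K` for every open `K` (`invariants_le_smoothVectors`), and is all of `V` iff `ρ` is smooth
  (`isSmooth_iff_smoothVectors_eq_top`);
* `smoothRep ρ : Representation k G (smoothVectors ρ)` — `V^∞` as a representation; it is smooth
  (`isSmooth_smoothRep`) and `invariantsSmoothRepEquiv : (V^∞)^K ≃ₗ[k] V^K` for `K` open;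
* the SMOOTH DUAL `π̃ = (V^*)^∞ = smoothVectors ρ.dual` (on Mathlib's contragredient
  `Representation.dual`; `smoothRep ρ.dual` is its representation), with the invariant pairing
  `dual_apply_apply` and `smoothVectors_dual_eq_iSup` (`π̃ = ⋃_K (π̃)^K` over the open `K`);
* `smoothDualInvariants ρ K := invariants ρ.dual K ⊓ smoothVectors ρ.dual` — `(π̃)^K` as a subspace
  of the algebraic dual — and `smoothDualInvariants_eq` — THE PASSAGE: for `K` open,
  `(π̃)^K = (V^*)^K`;
* `smoothDualInvariantsEquiv : (π̃)^K ≃ₗ[k] (π^K)^*` (`K` open, `ρ` `K`-finite, characteristic `0`;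
  T5-42's `dualInvariantsEquiv` transported), `finrank_smoothDualInvariants`,
  `finiteDimensional_smoothDualInvariants_of_isAdmissible` (the smooth dual of an admissible
  representation is admissible), and `doubleDualInvariantsEquiv : π^K ≃ₗ[k] ((π̃)^K)^*` (the
  double smooth dual at level `K`, from Mathlib's `Module.evalEquiv`).

In the record: `G` a td-group, `K` compact open, `π` smooth admissible; the sentence «`(π̃)^K =
(π^K)^*`, so `π̃` is admissible and `π ≅ π̃̃` level by level» is closed in kernel form.  What stays
prose: the Haar measure and the printed theorems.

README §8(d): uses an L-value-free non-vanishing device: NO.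
-/

namespace Summit.Ventures.HodgeRepro2.T5SmoothDual

noncomputable section

open Summit.Ventures.HodgeRepro2.LevelPositivity
open Summit.Ventures.HodgeRepro2.T5LevelIdempotent
open Summit.Ventures.HodgeRepro2.T5LevelIdempotentDual
open Summit.Ventures.HodgeRepro2.T5AdmissibleTransfer

variable {G : Type*} [Group G] [TopologicalSpace G] [IsTopologicalGroup G]
  {k : Type*} [Field k] {V : Type*} [AddCommGroup V] [Module k V]

section SmoothVectors

variable (ρ : Representation k G V)

omit [TopologicalSpace G] [IsTopologicalGroup G] in
/-- The stabiliser of a sum contains the intersection of the stabilisers. -/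
theorem inf_le_stabilizer_add (v w : V) :
    stabilizer ρ v ⊓ stabilizer ρ w ≤ stabilizer ρ (v + w) := by
  intro g hg
  rw [Subgroup.mem_inf, mem_stabilizer_iff, mem_stabilizer_iff] at hg
  rw [mem_stabilizer_iff, map_add, hg.1, hg.2]

omit [TopologicalSpace G] [IsTopologicalGroup G] in
/-- The stabiliser of `v` stabilises `c • v`. -/
theorem stabilizer_le_stabilizer_smul (c : k) (v : V) :
    stabilizer ρ v ≤ stabilizer ρ (c • v) := by
  intro g hg
  rw [mem_stabilizer_iff] at hg ⊢
  rw [map_smul, hg]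

omit [TopologicalSpace G] [IsTopologicalGroup G] in
/-- The stabiliser of `0` is everything. -/
theorem stabilizer_zero : stabilizer ρ (0 : V) = ⊤ := by
  ext g
  simp [mem_stabilizer_iff]

omit [TopologicalSpace G] [IsTopologicalGroup G] in
/-- The stabiliser of `ρ g v` is the conjugate by `g` of the stabiliser of `v`. -/
theorem coe_stabilizer_apply (g : G) (v : V) :
    (stabilizer ρ (ρ g v) : Set G) = (fun h => g⁻¹ * h * g) ⁻¹' (stabilizer ρ v : Set G) := by
  ext h
  simp only [Set.mem_preimage, SetLike.mem_coe, mem_stabilizer_iff]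
  have key : ρ h (ρ g v) = ρ g (ρ (g⁻¹ * h * g) v) := by
    rw [← Module.End.mul_apply, ← map_mul, ← Module.End.mul_apply, ← map_mul]
    congr 2
    group
  rw [key]
  constructor
  · intro hh
    have := congrArg (ρ g⁻¹) hh
    rwa [← Module.End.mul_apply, ← map_mul, inv_mul_cancel, map_one, Module.End.one_apply,
      ← Module.End.mul_apply, ← map_mul, inv_mul_cancel, map_one, Module.End.one_apply] at this
  · intro hh
    rw [hh]

/-- THE SMOOTH VECTORS `V^∞`: the vectors whose stabiliser is open. -/
def smoothVectors : Submodule k V where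
  carrier := {v | IsOpen (stabilizer ρ v : Set G)}
  add_mem' {v w} hv hw := Subgroup.isOpen_mono (inf_le_stabilizer_add ρ v w)
    (by rw [Subgroup.coe_inf]; exact hv.inter hw)
  zero_mem' := by
    show IsOpen (stabilizer ρ (0 : V) : Set G)
    rw [stabilizer_zero]
    exact isOpen_univ
  smul_mem' c v hv := Subgroup.isOpen_mono (stabilizer_le_stabilizer_smul ρ c v) hv

/-- Membership in `smoothVectors`. -/
theorem mem_smoothVectors_iff {v : V} : v ∈ smoothVectors ρ ↔ IsOpen (stabilizer ρ v : Set G) :=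
  Iff.rfl

/-- `ρ` is smooth iff every vector is smooth. -/
theorem isSmooth_iff_smoothVectors_eq_top : IsSmooth ρ ↔ smoothVectors ρ = ⊤ := by
  constructor
  · intro h
    exact eq_top_iff.2 fun v _ => h v
  · intro h v
    have : v ∈ smoothVectors ρ := h ▸ Submodule.mem_top
    exact this

/-- The `K`-fixed vectors are smooth for every open subgroup `K`. -/
theorem invariants_le_smoothVectors {K : Subgroup G} (hK : IsOpen (K : Set G)) :
    invariants ρ K ≤ smoothVectors ρ := by
  intro v hv
  rw [mem_smoothVectors_iff]
  apply Subgroup.isOpen_mono _ hK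
  intro g hg
  rw [mem_stabilizer_iff]
  exact mem_invariants_iff.mp hv g hg

/-- The smooth vectors form a subrepresentation. -/
theorem apply_mem_smoothVectors (g : G) {v : V} (hv : v ∈ smoothVectors ρ) :
    ρ g v ∈ smoothVectors ρ := by
  rw [mem_smoothVectors_iff, coe_stabilizer_apply]
  exact hv.preimage (by fun_prop)

/-- `V^∞` as a representation of `G`. -/
def smoothRep : Representation k G (smoothVectors ρ) where
  toFun g := (ρ g).restrict fun _ hv => apply_mem_smoothVectors ρ g hv
  map_one' := by ext; simp
  map_mul' g h := by ext; simp

/-- `smoothRep` acts through `ρ`. -/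
@[simp] theorem smoothRep_apply (g : G) (v : smoothVectors ρ) : (smoothRep ρ g v : V) = ρ g v := rfl

/-- The stabiliser of a smooth vector in `V^∞` is its stabiliser in `V`. -/
theorem coe_stabilizer_smoothRep (v : smoothVectors ρ) :
    (stabilizer (smoothRep ρ) v : Set G) = stabilizer ρ v.1 := by
  ext g
  simp only [SetLike.mem_coe, mem_stabilizer_iff, Subtype.ext_iff, smoothRep_apply]

/-- `V^∞` is a smooth representation. -/
theorem isSmooth_smoothRep : IsSmooth (smoothRep ρ) := by
  intro v
  rw [coe_stabilizer_smoothRep]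
  exact v.2

/-- The `K`-invariants of `V^∞` are the `K`-invariants of `V`, for `K` open. -/
def invariantsSmoothRepEquiv {K : Subgroup G} (hK : IsOpen (K : Set G)) :
    invariants (smoothRep ρ) K ≃ₗ[k] invariants ρ K where
  toFun v := ⟨v.1.1, by
    rw [mem_invariants_iff]
    intro g hg
    exact congrArg Subtype.val (mem_invariants_iff.mp v.2 g hg)⟩
  map_add' _ _ := rfl
  map_smul' _ _ := rfl
  invFun w := ⟨⟨w.1, invariants_le_smoothVectors ρ hK w.2⟩, by
    rw [mem_invariants_iff]
    intro g hg
    exact Subtype.ext (mem_invariants_iff.mp w.2 g hg)⟩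
  left_inv _ := rfl
  right_inv _ := rfl

/-- `invariantsSmoothRepEquiv` is the inclusion. -/
@[simp] theorem invariantsSmoothRepEquiv_apply {K : Subgroup G} (hK : IsOpen (K : Set G))
    (v : invariants (smoothRep ρ) K) : (invariantsSmoothRepEquiv ρ hK v : V) = v.1.1 := rfl

end SmoothVectors

section SmoothDual

variable (ρ : Representation k G V)

omit [TopologicalSpace G] [IsTopologicalGroup G] in
/-- The pairing between `ρ.dual` and `ρ` is `G`-invariant: `⟨ρ̃(g) l, ρ(g) v⟩ = ⟨l, v⟩`. -/
theorem dual_apply_apply (g : G) (l : Module.Dual k V) (v : V) :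
    ρ.dual g l (ρ g v) = l v := by
  rw [Representation.dual_apply, Module.Dual.transpose_apply, LinearMap.comp_apply,
    ← Module.End.mul_apply, ← map_mul, inv_mul_cancel, map_one, Module.End.one_apply]

/-- THE `K`-INVARIANTS OF THE SMOOTH DUAL `π̃ = (V^*)^∞`, as a subspace of the algebraic dual:
the `K`-fixed functionals that are smooth vectors of `ρ.dual`. -/
def smoothDualInvariants (K : Subgroup G) : Submodule k (Module.Dual k V) :=
  invariants ρ.dual K ⊓ smoothVectors ρ.dual

/-- Membership in `smoothDualInvariants`. -/
theorem mem_smoothDualInvariants_iff {K : Subgroup G} {l : Module.Dual k V} :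
    l ∈ smoothDualInvariants ρ K ↔ l ∈ invariants ρ.dual K ∧ l ∈ smoothVectors ρ.dual :=
  Submodule.mem_inf

/-- THE PASSAGE FROM THE ALGEBRAIC DUAL TO THE SMOOTH DUAL: for `K` open, the `K`-invariants of the
smooth dual are the `K`-invariants of the algebraic dual. -/
theorem smoothDualInvariants_eq {K : Subgroup G} (hK : IsOpen (K : Set G)) :
    smoothDualInvariants ρ K = invariants ρ.dual K :=
  inf_eq_left.2 (invariants_le_smoothVectors ρ.dual hK)

/-- The smooth dual is the union of the `(π̃)^K` over the open subgroups `K` (every smooth functional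
is fixed by its open stabiliser). -/
theorem smoothVectors_dual_eq_iSup :
    smoothVectors ρ.dual = ⨆ (K : Subgroup G) (_ : IsOpen (K : Set G)), smoothDualInvariants ρ K := by
  apply le_antisymm
  · intro l hl
    have hmem : l ∈ smoothDualInvariants ρ (stabilizer ρ.dual l) := by
      rw [mem_smoothDualInvariants_iff]
      refine ⟨?_, hl⟩
      rw [mem_invariants_iff]
      intro g hg
      exact mem_stabilizer_iff.mp hg
    exact Submodule.mem_iSup_of_mem (stabilizer ρ.dual l) (Submodule.mem_iSup_of_mem hl hmem)
  · refine iSup_le fun K => iSup_le fun _ => ?_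
    exact inf_le_right

variable [CharZero k] {K : Subgroup G}

/-- `(π̃)^K ≃ (π^K)^*` for `K` open and `ρ` `K`-finite (characteristic `0`): T5-42's
`dualInvariantsEquiv` transported along `smoothDualInvariants_eq`. -/
def smoothDualInvariantsEquiv (hK : IsOpen (K : Set G)) (hρ : KFinite ρ K) :
    smoothDualInvariants ρ K ≃ₗ[k] Module.Dual k (invariants ρ K) :=
  (LinearEquiv.ofEq _ _ (smoothDualInvariants_eq ρ hK)).trans (dualInvariantsEquiv ρ hρ)

/-- `smoothDualInvariantsEquiv` is evaluation. -/
theorem smoothDualInvariantsEquiv_apply (hK : IsOpen (K : Set G)) (hρ : KFinite ρ K)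
    (l : smoothDualInvariants ρ K) (x : invariants ρ K) :
    smoothDualInvariantsEquiv ρ hK hρ l x = (l : Module.Dual k V) x := by
  simp [smoothDualInvariantsEquiv, dualInvariantsEquiv_apply]

/-- `dim (π̃)^K = dim π^K`. -/
theorem finrank_smoothDualInvariants (hK : IsOpen (K : Set G)) (hρ : KFinite ρ K) :
    Module.finrank k (smoothDualInvariants ρ K) = Module.finrank k (invariants ρ K) := by
  rw [smoothDualInvariants_eq ρ hK, finrank_invariants_dual ρ hρ]

/-- `(π̃)^K` is finite-dimensional when `π^K` is. -/
theorem finiteDimensional_smoothDualInvariants (hK : IsOpen (K : Set G)) (hρ : KFinite ρ K)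
    [FiniteDimensional k (invariants ρ K)] :
    FiniteDimensional k (smoothDualInvariants ρ K) := by
  rw [smoothDualInvariants_eq ρ hK]
  exact finiteDimensional_invariants_dual ρ hρ

/-- THE SMOOTH DUAL OF AN ADMISSIBLE REPRESENTATION IS ADMISSIBLE: `(π̃)^K` is finite-dimensional
for every `K` in a family of open subgroups on which `ρ` is admissible and `K`-finite
(characteristic `0`). -/
theorem finiteDimensional_smoothDualInvariants_of_isAdmissible {𝒦 : Set (Subgroup G)}
    (hopen : ∀ K ∈ 𝒦, IsOpen (K : Set G)) (hfin : ∀ K ∈ 𝒦, KFinite ρ K)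
    (h : IsAdmissible ρ 𝒦) : ∀ K ∈ 𝒦, FiniteDimensional k (smoothDualInvariants ρ K) := by
  intro K hK
  haveI := h K hK
  exact finiteDimensional_smoothDualInvariants ρ (hopen K hK) (hfin K hK)

/-- The double smooth dual at level `K`: evaluation `π^K ≃ ((π̃)^K)^*` when `π^K` is
finite-dimensional. -/
def doubleDualInvariantsEquiv (hK : IsOpen (K : Set G)) (hρ : KFinite ρ K)
    [FiniteDimensional k (invariants ρ K)] :
    invariants ρ K ≃ₗ[k] Module.Dual k (smoothDualInvariants ρ K) :=
  (Module.evalEquiv k (invariants ρ K)).trans (smoothDualInvariantsEquiv ρ hK hρ).dualMap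

/-- `doubleDualInvariantsEquiv` is evaluation. -/
theorem doubleDualInvariantsEquiv_apply (hK : IsOpen (K : Set G)) (hρ : KFinite ρ K)
    [FiniteDimensional k (invariants ρ K)] (x : invariants ρ K) (l : smoothDualInvariants ρ K) :
    doubleDualInvariantsEquiv ρ hK hρ x l = (l : Module.Dual k V) x := by
  simp [doubleDualInvariantsEquiv, Module.evalEquiv_apply, smoothDualInvariantsEquiv_apply]

end SmoothDual

end

end Summit.Ventures.HodgeRepro2.T5SmoothDual
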